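import Summits.QuantumFields.GaugeBoot.SU2WeakCouplingRateUniform
import HarnessLib

/-!
# Gauge-boot: analytic shape-(A) windows for `SU(2)` at weak coupling
# (large-`N` supplement 17, part 12 — the uniform rate in the cell's certificate format)

HONEST FRAMING (cell `pub-gaugeboot`, page 1 of every file): certified bounds on lattice
expectations at STATED coupling, gauge group, dimension and torus size; NOT a mass gap, NOT a
continuum limit, NOT a string tension, NOT large `N`; NOT Yang–Mills-summit-bearing (barriers
`FixedCouplingUltralocality`, `PerturbativeInvisibility`).  These windows are ANALYTIC and WEAK: at the
couplings of the cell's tables (`β_std ≤ 10`) their lower end is below `0` and says nothing; they carry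
content only for large `β_std` (e.g. `D = 4`: `a ≈ 0.76` at `β_std = 100`, `a ≈ 0.97` at `β_std = 1000`), where no SDP
certificate of the cell exists.  They certify no number of CERTIFIED.md.

## Content

* `plaquetteExpectation_le_one'` — `plaquetteExpectation N D L β ≤ 1` (`|ū_P| ≤ 1`);
* ★★ `plaquetteWindow_weakCoupling` — for `SU(2)`, `D ≥ 2`, `β_std ≥ 2` and EVERY `L₀`:
  `PlaquetteWindow 2 D L₀ β_std (1 − 2(1 + (2/(D−1))(log 4096 + 2 log(β_std/2)))/β_std) 1` — a shape-(A)
  window (SCOPING §1.2) valid for all torus sides, produced by part 10 instead of an SDP; by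
  `LimitPoints.PlaquetteWindow.integral_limit_mem` and part 11 it passes to infinite-volume limit points.
[folklore]
-/

noncomputable section

open MeasureTheory
open Literature.MathematicalPhysics.QuantumFieldTheory

namespace Summit.QuantumFields.GaugeBoot

namespace SU2Rate

/-- `plaquetteExpectation N D L β ≤ 1` (the mean plaquette is bounded by `1` pointwise). [folklore] -/
theorem plaquetteExpectation_le_one' (N D L : ℕ) [NeZero L] (β : ℝ) : plaquetteExpectation N D L β ≤ 1 := by
  unfold plaquetteExpectation
  haveI := isProbabilityMeasure_wilsonMeasure (d := D) (L := L) (G := SU N) (suRep N) (continuous_suRep N) (β / N)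
  refine (le_abs_self _).trans ((abs_wilsonExpectation_le (suRep N) (β / N) _).trans ?_)
  unfold wilsonExpectation
  calc ∫ U, |meanPlaquette (d := D) (L := L) (G := SU N) (suRep N) U| ∂wilsonMeasure (suRep N) (β / N)
      ≤ ∫ _U, (1 : ℝ) ∂wilsonMeasure (suRep N) (β / N) :=
        integral_mono_of_nonneg (Filter.Eventually.of_forall fun _ => abs_nonneg _) (integrable_const _)
          (Filter.Eventually.of_forall fun U => abs_meanPlaquette_le_one (suRep N) (continuous_suRep N) U)
    _ = 1 := by simp

/-- ★★ **Analytic weak-coupling windows for `SU(2)`**: for `D ≥ 2`, `β_std ≥ 2` and every `L₀`, the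
shape-(A) window `PlaquetteWindow 2 D L₀ β_std (1 − 2(1 + (2/(D−1))(log 4096 + 2 log(β_std/2)))/β_std) 1`
holds (for ALL torus sides, even or odd). [folklore] -/
theorem plaquetteWindow_weakCoupling {D : ℕ} (hD : 2 ≤ D) (L₀ : ℕ) {β : ℝ} (hβ : 2 ≤ β) :
    PlaquetteWindow 2 D L₀ β (1 - 2 * (1 + 2 / ((D : ℝ) - 1) * (Real.log 4096 + 2 * Real.log (β / 2))) / β) 1 := by
  intro L _ _ _
  refine ⟨?_, plaquetteExpectation_le_one' 2 D L β⟩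
  have h := one_sub_plaquetteExpectation_two_le_uniform (D := D) (L := L) hD hβ
  linarith

end SU2Rate

end Summit.QuantumFields.GaugeBoot

end
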